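import Literature.MathematicalPhysics.QuantumLattice.HubbardRingExchangeSpinWaves

/-!
# The `t–t′–t″–U` linear-spin-wave dispersion used to fit cuprate magnons (Ivashko et al. 2019, Methods Eqs. (3)–(4)) and its reduction to the `t`-only form

Companion to `HubbardRingExchangeDictionary.lean` / `HubbardRingExchangeSpinWaves.lean`, which
treat the nearest-neighbour-hopping (`t`-only) fourth-order model.  When second- and
third-neighbour hoppings `t′, t″` are kept, the strong-coupling projection of the half-filled
one-band Hubbard model to order `t⁴/U³` [DelannoyEtAl2009] gives, in linear spin-wave theory with
a uniform renormalisation `Z`, the magnon dispersion `ω(q) = Z √(A(q)² − B(q)²)` with the CLOSED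
FORMS printed in [IvashkoEtAl2019, Methods Eqs. (3)–(4)] (after [IvashkoEtAl2017];
[DallapiazzaEtAl2012]): with `P_j = cos jh + cos jk`, `X_j = cos jh · cos jk`,
`X_3a = cos 3h cos k + cos h cos 3k` (angles `h, k` = `2π ×` reciprocal-lattice units) and the
SECOND-order scales `J₁ = 4t²/U, J₂ = 4t⁴/U³, J₁′ = 4t′²/U, J₂′ = 4t′⁴/U³, J₁″ = 4t″²/U, J₂″ = 4t″⁴/U³`,
```
A = 2J₁ + J₂(P₂ − 8X₁ − 26) + 2J₁′(X₁ − 1) + [J₁″ − (8J₁/U²)(−t′² + 4t′t″ − 2t″²)](P₂ − 2)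
    + 2J₂′(−2P₂ + 4X₁ + X₂ − 1) + (2J₁′J₁″/U)(5P₂ + 2X₁ − 3X₂ − X_3a − 7) + J₂″(4P₂ + P₄ − 8X₂ − 2),
B = −J₁P₁ + 16J₂P₁ − (4J₁/U²)[(6t′² − t′t″)(X₁ − 1) + 3t″²(P₂ − 2)]P₁.
```
This is the dispersion fitted to the RIXS magnons of strained La₂CuO₄ films (at `U/t = 9`,
`Z = 1.219`, `t″ = −t′/2`) in [IvashkoEtAl2019, Table 1], and (in an equivalent form) to
La₂CuO₄ / Sr₂CuO₂Cl₂ / Bi₂Sr₂YCu₂O₈ in [DallapiazzaEtAl2012, Table I].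

Here `A`, `B`, `ω` are DEFINITIONS (`lswtA3`, `lswtB3`, `lswtOmega3`, with the printed
coefficients transcribed from the arXiv TeX source of [IvashkoEtAl2019], arXiv:1805.07173v3) and
the theorems are exact consequences:

* §2 **consistency with the `t`-only form** (a cross-source check, Coldea 2001 ↔ Ivashko 2019):
  at `t′ = t″ = 0`, `A = 2·A_Coldea`, `B = −2·B_Coldea` with Coldea's couplings set to the
  fourth-order values `J = 4t²/U − 24t⁴/U³`, `J′ = J″ = 4t⁴/U³`, `J_c = 80t⁴/U³` (file 1), hence
  `Z√(A² − B²)` equals file 2's `lswtOmega Z …` exactly (`lswtOmega3_eq_lswtOmega_of_tprime_zero`);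
* §3 the zone-boundary and zone-centre evaluations of the general form: `B = 0` at `(½,0)` and
  `(¼,¼)`, `A(½,0) = 8t²/U − 64t⁴/U³ − 16t′²/U − 64t′⁴/U³` (no `t″` dependence),
  `A(¼,¼)` in closed form, and the Goldstone zero `ω(0,0) = 0` for all `t, t′, t″`;
* §4 with the fitting convention `t″ = −t′/2`: the EXACT zone-boundary dispersion
  `A(½,0) − A(¼,¼) = 48t⁴/U³ − 4t′²/U + 448t²t′²/U³ + 68t′⁴/U³`, which exceeds the printed
  approximation `12ZJ₂[1 + (112 − J₁/J₂)(t′/t)²/12]` [IvashkoEtAl2019, Methods Eq. (5)] by exactly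
  the dropped `17ZJ₂′ = 68Zt′⁴/U³`;
* §5 worked instance: the Table-1 fit parameters of the LCO/LaSrAlO₄ film (`t = 613.2` meV,
  `t′/t = −0.422`, `U = 9t`, `Z = 1.219`) put `Z·A(½,0)` inside `(359, 361)` meV — the paper's
  «LCO/LSAO magnon reaches about 360 meV» at `(½,0)`; LCO/SrTiO₃ (`460.5`, `−0.389`) gives
  `(297, 298)` meV («a comparative softening of 60 meV»).

Not here: the derivation (canonical transformation + `1/S`), intensities, the general-lattice
operator form of [DallapiazzaEtAl2012, Eq. (2)], or any claim that these fits determine `U`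
(they are performed at imposed `U/t`).

References: O. Ivashko et al., Nature Commun. 10 (2019) 786, arXiv:1805.07173, Methods
Eqs. (2)–(6), Table 1; O. Ivashko et al., Phys. Rev. B 95 (2017) 214508; B. Dalla Piazza et al.,
Phys. Rev. B 85 (2012) 100508(R), arXiv:1104.4224; J.-Y. P. Delannoy, M. J. P. Gingras,
P. C. W. Holdsworth, A.-M. S. Tremblay, Phys. Rev. B 79 (2009) 235130.
AI-produced formalisation (H21, cell hubbard-downfold, seat lit-2, 2026-08-27); no facts, no
axioms beyond Mathlib's, no `sorry`.
-/

namespace Literature.MathematicalPhysics.QuantumLattice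

open Real

noncomputable section

/-! ## 1. The printed dispersion -/

/-- `P_j(h,k) = cos(jh) + cos(jk)` (in the `ν` convention of file 2: `ν(jh) + ν(jk)`).
[cite: IvashkoEtAl2019, Methods Eq. (3)] -/
def lswtP (j h k : ℝ) : ℝ := lswtNu (j * h) + lswtNu (j * k)

/-- `X_j(h,k) = cos(jh) cos(jk)`. [cite: IvashkoEtAl2019, Methods Eq. (3)] -/
def lswtX (j h k : ℝ) : ℝ := lswtNu (j * h) * lswtNu (j * k)

/-- `X_3a(h,k) = cos 3h cos k + cos h cos 3k`. [cite: IvashkoEtAl2019, Methods Eq. (3)] -/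
def lswtX3a (h k : ℝ) : ℝ := lswtNu (3 * h) * lswtNu k + lswtNu h * lswtNu (3 * k)

/-- The second-order scale `4s²/U` of a hopping `s` (`J₁ = 4t²/U`, `J₁′ = 4t′²/U`, `J₁″ = 4t″²/U`).
[cite: IvashkoEtAl2019, Methods Eq. (4)] -/
def lswtJa (s U : ℝ) : ℝ := 4 * s ^ 2 / U

/-- The fourth-order scale `4s⁴/U³` of a hopping `s` (`J₂ = 4t⁴/U³`, `J₂′`, `J₂″`).
[cite: IvashkoEtAl2019, Methods Eq. (4)] -/
def lswtJb (s U : ℝ) : ℝ := 4 * s ^ 4 / U ^ 3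

/-- `A(q)` of the `t–t′–t″–U` linear-spin-wave dispersion, as printed.
[cite: IvashkoEtAl2019, Methods Eq. (3)] -/
def lswtA3 (t tp tpp U h k : ℝ) : ℝ :=
  2 * lswtJa t U + lswtJb t U * (lswtP 2 h k - 8 * lswtX 1 h k - 26)
    + 2 * lswtJa tp U * (lswtX 1 h k - 1)
    + (lswtJa tpp U - 8 * lswtJa t U / U ^ 2 * (-tp ^ 2 + 4 * tp * tpp - 2 * tpp ^ 2))
        * (lswtP 2 h k - 2)
    + 2 * lswtJb tp U * (-2 * lswtP 2 h k + 4 * lswtX 1 h k + lswtX 2 h k - 1)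
    + 2 * lswtJa tp U * lswtJa tpp U / U
        * (5 * lswtP 2 h k + 2 * lswtX 1 h k - 3 * lswtX 2 h k - lswtX3a h k - 7)
    + lswtJb tpp U * (4 * lswtP 2 h k + lswtP 4 h k - 8 * lswtX 2 h k - 2)

/-- `B(q)` of the `t–t′–t″–U` linear-spin-wave dispersion, as printed.
[cite: IvashkoEtAl2019, Methods Eq. (4)] -/
def lswtB3 (t tp tpp U h k : ℝ) : ℝ :=
  -lswtJa t U * lswtP 1 h k + 16 * lswtJb t U * lswtP 1 h k
    - 4 * lswtJa t U / U ^ 2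
        * ((6 * tp ^ 2 - tp * tpp) * (lswtX 1 h k - 1) + 3 * tpp ^ 2 * (lswtP 2 h k - 2))
        * lswtP 1 h k

/-- `ω(q) = Z √(A(q)² − B(q)²)`. [cite: IvashkoEtAl2019, Methods Eq. (2)] -/
def lswtOmega3 (Z t tp tpp U h k : ℝ) : ℝ :=
  Z * sqrt (lswtA3 t tp tpp U h k ^ 2 - lswtB3 t tp tpp U h k ^ 2)

/-- Unfolding. [cite: IvashkoEtAl2019, Methods Eq. (3)] -/
theorem lswtP_def (j h k : ℝ) : lswtP j h k = lswtNu (j * h) + lswtNu (j * k) := rfl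

/-- Unfolding. [cite: IvashkoEtAl2019, Methods Eq. (3)] -/
theorem lswtX_def (j h k : ℝ) : lswtX j h k = lswtNu (j * h) * lswtNu (j * k) := rfl

/-- Unfolding. [cite: IvashkoEtAl2019, Methods Eq. (3)] -/
theorem lswtX3a_def (h k : ℝ) :
    lswtX3a h k = lswtNu (3 * h) * lswtNu k + lswtNu h * lswtNu (3 * k) := rfl

/-- Unfolding. [cite: IvashkoEtAl2019, Methods Eq. (4)] -/
theorem lswtJa_def (s U : ℝ) : lswtJa s U = 4 * s ^ 2 / U := rfl

/-- Unfolding. [cite: IvashkoEtAl2019, Methods Eq. (4)] -/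
theorem lswtJb_def (s U : ℝ) : lswtJb s U = 4 * s ^ 4 / U ^ 3 := rfl

/-- Unfolding. [cite: IvashkoEtAl2019, Methods Eq. (2)] -/
theorem lswtOmega3_def (Z t tp tpp U h k : ℝ) : lswtOmega3 Z t tp tpp U h k =
    Z * sqrt (lswtA3 t tp tpp U h k ^ 2 - lswtB3 t tp tpp U h k ^ 2) := rfl

/-- `J₁ − 6J₂` is file 1's fourth-order nearest-neighbour coupling `scJ1`, `J₂ = scJ2`,
`20J₂ = scJc`. [cite: IvashkoEtAl2019, Methods Eq. (4)] -/
theorem lswtJa_lswtJb_sc (t U : ℝ) :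
    lswtJa t U - 6 * lswtJb t U = scJ1 t U ∧ lswtJb t U = scJ2 t U ∧ 20 * lswtJb t U = scJc t U := by
  unfold lswtJa lswtJb scJ1 scJ2 scJc
  refine ⟨by ring, rfl, by ring⟩

/-! ## 2. Consistency with the `t`-only (Coldea) form at `t′ = t″ = 0` -/

/-- At `t′ = t″ = 0`, `A = 2 A_Coldea` with Coldea's couplings at their fourth-order values.
[cite: IvashkoEtAl2019, Methods Eq. (3)] -/
theorem lswtA3_tprime_zero (t U h k : ℝ) :
    lswtA3 t 0 0 U h k = 2 * lswtA (scJ1 t U) (scJ2 t U) (scJ2 t U) (scJc t U) h k := by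
  unfold lswtA3 lswtA lswtP lswtX lswtX3a lswtJa lswtJb scJ1 scJ2 scJc
  simp only [one_mul]
  ring

/-- At `t′ = t″ = 0`, `B = −2 B_Coldea`. [cite: IvashkoEtAl2019, Methods Eq. (4)] -/
theorem lswtB3_tprime_zero (t U h k : ℝ) :
    lswtB3 t 0 0 U h k = -2 * lswtB (scJ1 t U) (scJc t U) h k := by
  unfold lswtB3 lswtB lswtP lswtX lswtJa lswtJb scJ1 scJc
  simp only [one_mul]
  ring

/-- **Cross-source consistency**: at `t′ = t″ = 0` the Ivashko/Delannoy dispersion coincides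
with Coldea's `2Z_c√(A_C² − B_C²)` evaluated at the fourth-order couplings (same `Z`).
[cite: IvashkoEtAl2019, Methods Eq. (2)] -/
theorem lswtOmega3_eq_lswtOmega_of_tprime_zero (Z t U h k : ℝ) :
    lswtOmega3 Z t 0 0 U h k = lswtOmega Z (scJ1 t U) (scJ2 t U) (scJ2 t U) (scJc t U) h k := by
  unfold lswtOmega3 lswtOmega
  rw [lswtA3_tprime_zero, lswtB3_tprime_zero]
  set A := lswtA (scJ1 t U) (scJ2 t U) (scJ2 t U) (scJc t U) h k
  set B := lswtB (scJ1 t U) (scJc t U) h k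
  have h4 : (2 * A) ^ 2 - (-2 * B) ^ 2 = 4 * (A ^ 2 - B ^ 2) := by ring
  have hs4 : sqrt 4 = (2 : ℝ) := by
    rw [show (4 : ℝ) = 2 ^ 2 by norm_num]; exact sqrt_sq (by norm_num)
  rw [h4, sqrt_mul (by norm_num : (0:ℝ) ≤ 4), hs4]
  ring

/-! ## 3. Zone-boundary and zone-centre values of the general form -/

/-- `ν(3/2) = cos 3π = −1`. [cite: IvashkoEtAl2019, Methods Eq. (3)] -/
theorem lswtNu_three_halves : lswtNu (3 / 2) = -1 := by
  rw [show (3 / 2 : ℝ) = 1 / 2 + 1 by norm_num, lswtNu_add_one, lswtNu_half]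

/-- `ν(3/4) = cos(3π/2) = 0`. [cite: IvashkoEtAl2019, Methods Eq. (3)] -/
theorem lswtNu_three_quarters : lswtNu (3 / 4) = 0 := by
  rw [show (3 / 4 : ℝ) = -(1 / 4) + 1 by norm_num, lswtNu_add_one, lswtNu_neg, lswtNu_quarter]

/-- `ν(2) = cos 4π = 1`. [cite: IvashkoEtAl2019, Methods Eq. (3)] -/
theorem lswtNu_two : lswtNu 2 = 1 := by
  rw [show (2 : ℝ) = 1 + 1 by norm_num, lswtNu_add_one, lswtNu_one]

/-- The trigonometric building blocks at `(½, 0)`: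
`P₁ = 0, P₂ = 2, P₄ = 2, X₁ = −1, X₂ = 1, X_3a = −2`. [cite: IvashkoEtAl2019, Methods Eq. (3)] -/
theorem lswt_blocks_half_zero :
    lswtP 1 (1 / 2) 0 = 0 ∧ lswtP 2 (1 / 2) 0 = 2 ∧ lswtP 4 (1 / 2) 0 = 2 ∧
      lswtX 1 (1 / 2) 0 = -1 ∧ lswtX 2 (1 / 2) 0 = 1 ∧ lswtX3a (1 / 2) 0 = -2 := by
  unfold lswtP lswtX lswtX3a
  rw [show (1 : ℝ) * (1 / 2) = 1 / 2 by norm_num, show (2 : ℝ) * (1 / 2) = 1 by norm_num,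
    show (4 : ℝ) * (1 / 2) = 2 by norm_num, show (3 : ℝ) * (1 / 2) = 3 / 2 by norm_num,
    mul_zero, mul_zero, mul_zero, mul_zero, lswtNu_half, lswtNu_zero, lswtNu_one, lswtNu_two,
    lswtNu_three_halves]
  norm_num

/-- The building blocks at `(¼, ¼)`: `P₁ = 0, P₂ = −2, P₄ = 2, X₁ = 0, X₂ = 1, X_3a = 0`.
[cite: IvashkoEtAl2019, Methods Eq. (3)] -/
theorem lswt_blocks_quarter_quarter :
    lswtP 1 (1 / 4) (1 / 4) = 0 ∧ lswtP 2 (1 / 4) (1 / 4) = -2 ∧ lswtP 4 (1 / 4) (1 / 4) = 2 ∧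
      lswtX 1 (1 / 4) (1 / 4) = 0 ∧ lswtX 2 (1 / 4) (1 / 4) = 1 ∧ lswtX3a (1 / 4) (1 / 4) = 0 := by
  unfold lswtP lswtX lswtX3a
  rw [show (1 : ℝ) * (1 / 4) = 1 / 4 by norm_num, show (2 : ℝ) * (1 / 4) = 1 / 2 by norm_num,
    show (4 : ℝ) * (1 / 4) = 1 by norm_num, show (3 : ℝ) * (1 / 4) = 3 / 4 by norm_num,
    lswtNu_quarter, lswtNu_half, lswtNu_one, lswtNu_three_quarters]
  norm_num

/-- The building blocks at `(0, 0)`: `P_j = 2, X_j = 1, X_3a = 2`. [cite: IvashkoEtAl2019, Methods Eq. (3)] -/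
theorem lswt_blocks_zero_zero (j : ℝ) :
    lswtP j 0 0 = 2 ∧ lswtX j 0 0 = 1 ∧ lswtX3a 0 0 = 2 := by
  unfold lswtP lswtX lswtX3a
  rw [mul_zero, mul_zero, lswtNu_zero]
  norm_num

/-- `B(½, 0) = 0` for all `t, t′, t″, U`. [cite: IvashkoEtAl2019, Methods Eq. (4)] -/
theorem lswtB3_half_zero (t tp tpp U : ℝ) : lswtB3 t tp tpp U (1 / 2) 0 = 0 := by
  obtain ⟨hP1, -, -, -, -, -⟩ := lswt_blocks_half_zero
  unfold lswtB3; rw [hP1]; ring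

/-- `A(½, 0) = 8t²/U − 64t⁴/U³ − 16t′²/U − 64t′⁴/U³` — independent of `t″`.
[cite: IvashkoEtAl2019, Methods Eq. (3)] -/
theorem lswtA3_half_zero (t tp tpp U : ℝ) : lswtA3 t tp tpp U (1 / 2) 0 =
    8 * t ^ 2 / U - 64 * t ^ 4 / U ^ 3 - 16 * tp ^ 2 / U - 64 * tp ^ 4 / U ^ 3 := by
  obtain ⟨hP1, hP2, hP4, hX1, hX2, hX3⟩ := lswt_blocks_half_zero
  unfold lswtA3; rw [hP2, hP4, hX1, hX2, hX3]; unfold lswtJa lswtJb; ring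

/-- `ω(½, 0) = Z |8t²/U − 64t⁴/U³ − 16t′²/U − 64t′⁴/U³|`. [cite: IvashkoEtAl2019, Methods Eq. (2)] -/
theorem lswtOmega3_half_zero (Z t tp tpp U : ℝ) : lswtOmega3 Z t tp tpp U (1 / 2) 0 =
    Z * |8 * t ^ 2 / U - 64 * t ^ 4 / U ^ 3 - 16 * tp ^ 2 / U - 64 * tp ^ 4 / U ^ 3| := by
  unfold lswtOmega3
  rw [lswtA3_half_zero, lswtB3_half_zero, zero_pow two_ne_zero, sub_zero, sqrt_sq_eq_abs]

/-- `B(¼, ¼) = 0` for all `t, t′, t″, U`. [cite: IvashkoEtAl2019, Methods Eq. (4)] -/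
theorem lswtB3_quarter_quarter (t tp tpp U : ℝ) : lswtB3 t tp tpp U (1 / 4) (1 / 4) = 0 := by
  obtain ⟨hP1, -, -, -, -, -⟩ := lswt_blocks_quarter_quarter
  unfold lswtB3; rw [hP1]; ring

/-- `A(¼, ¼)` in closed form:
`8t²/U − 112t⁴/U³ − 8t′²/U − 16t″²/U + 128t²(−t′² + 4t′t″ − 2t″²)/U³ + 32t′⁴/U³ − 640t′²t″²/U³ − 64t″⁴/U³`.
[cite: IvashkoEtAl2019, Methods Eq. (3)] -/
theorem lswtA3_quarter_quarter (t tp tpp U : ℝ) : lswtA3 t tp tpp U (1 / 4) (1 / 4) =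
    8 * t ^ 2 / U - 112 * t ^ 4 / U ^ 3 - 8 * tp ^ 2 / U - 16 * tpp ^ 2 / U
      + 128 * t ^ 2 * (-tp ^ 2 + 4 * tp * tpp - 2 * tpp ^ 2) / U ^ 3
      + 32 * tp ^ 4 / U ^ 3 - 640 * tp ^ 2 * tpp ^ 2 / U ^ 3 - 64 * tpp ^ 4 / U ^ 3 := by
  obtain ⟨hP1, hP2, hP4, hX1, hX2, hX3⟩ := lswt_blocks_quarter_quarter
  unfold lswtA3; rw [hP2, hP4, hX1, hX2, hX3]; unfold lswtJa lswtJb; ring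

/-- `ω(¼, ¼) = Z |A(¼, ¼)|`. [cite: IvashkoEtAl2019, Methods Eq. (2)] -/
theorem lswtOmega3_quarter_quarter (Z t tp tpp U : ℝ) : lswtOmega3 Z t tp tpp U (1 / 4) (1 / 4) =
    Z * |lswtA3 t tp tpp U (1 / 4) (1 / 4)| := by
  unfold lswtOmega3
  rw [lswtB3_quarter_quarter, zero_pow two_ne_zero, sub_zero, sqrt_sq_eq_abs]

/-- `A(0,0) = 2J₁ − 32J₂ = 8t²/U − 128t⁴/U³` for all `t′, t″` (every `t′, t″` term vanishes at the
zone centre). [cite: IvashkoEtAl2019, Methods Eq. (3)] -/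
theorem lswtA3_zero_zero (t tp tpp U : ℝ) :
    lswtA3 t tp tpp U 0 0 = 8 * t ^ 2 / U - 128 * t ^ 4 / U ^ 3 := by
  obtain ⟨hP2, hX1, hX3⟩ := lswt_blocks_zero_zero 2
  obtain ⟨hP4, hX2, -⟩ := lswt_blocks_zero_zero 4
  obtain ⟨hP1, hX1', -⟩ := lswt_blocks_zero_zero 1
  have hX2' : lswtX 2 0 0 = 1 := (lswt_blocks_zero_zero 2).2.1
  unfold lswtA3; rw [hP2, hP4, hX1', hX2', hX3]; unfold lswtJa lswtJb; ring

/-- `B(0,0) = −(8t²/U − 128t⁴/U³)` for all `t′, t″`. [cite: IvashkoEtAl2019, Methods Eq. (4)] -/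
theorem lswtB3_zero_zero (t tp tpp U : ℝ) :
    lswtB3 t tp tpp U 0 0 = -(8 * t ^ 2 / U - 128 * t ^ 4 / U ^ 3) := by
  obtain ⟨hP1, hX1, -⟩ := lswt_blocks_zero_zero 1
  obtain ⟨hP2, -, -⟩ := lswt_blocks_zero_zero 2
  unfold lswtB3; rw [hP1, hP2, hX1]; unfold lswtJa lswtJb; ring

/-- **Goldstone zero** of the general form: `ω(0,0) = 0` for all `t, t′, t″, U, Z`.
[cite: IvashkoEtAl2019, Methods Eq. (2)] -/
theorem lswtOmega3_zero_zero (Z t tp tpp U : ℝ) : lswtOmega3 Z t tp tpp U 0 0 = 0 := by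
  unfold lswtOmega3; rw [lswtA3_zero_zero, lswtB3_zero_zero, neg_sq, sub_self, sqrt_zero, mul_zero]

/-! ## 4. The fitting convention `t″ = −t′/2` and the printed zone-boundary approximation -/

/-- **Exact zone-boundary difference** of `A` under `t″ = −t′/2`:
`A(½,0) − A(¼,¼) = 48t⁴/U³ − 4t′²/U + 448t²t′²/U³ + 68t′⁴/U³`.
[cite: IvashkoEtAl2019, Methods Eq. (5)] -/
theorem lswtA3_zoneBoundary_diff (t tp U : ℝ) :
    lswtA3 t tp (-tp / 2) U (1 / 2) 0 - lswtA3 t tp (-tp / 2) U (1 / 4) (1 / 4) =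
      48 * t ^ 4 / U ^ 3 - 4 * tp ^ 2 / U + 448 * t ^ 2 * tp ^ 2 / U ^ 3 + 68 * tp ^ 4 / U ^ 3 := by
  rw [lswtA3_half_zero, lswtA3_quarter_quarter]; ring

/-- **`E_ZB` exactly**, when both zone-boundary `A`'s are non-negative (the antiferromagnetic
regime of the fits): `ω(½,0) − ω(¼,¼) = Z(48t⁴/U³ − 4t′²/U + 448t²t′²/U³ + 68t′⁴/U³)`.
[cite: IvashkoEtAl2019, Methods Eq. (5)] -/
theorem lswtOmega3_zoneBoundary (Z t tp U : ℝ) (h₁ : 0 ≤ lswtA3 t tp (-tp / 2) U (1 / 2) 0)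
    (h₂ : 0 ≤ lswtA3 t tp (-tp / 2) U (1 / 4) (1 / 4)) :
    lswtOmega3 Z t tp (-tp / 2) U (1 / 2) 0 - lswtOmega3 Z t tp (-tp / 2) U (1 / 4) (1 / 4) =
      Z * (48 * t ^ 4 / U ^ 3 - 4 * tp ^ 2 / U + 448 * t ^ 2 * tp ^ 2 / U ^ 3 + 68 * tp ^ 4 / U ^ 3) := by
  rw [lswtOmega3_quarter_quarter, abs_of_nonneg h₂, ← lswtA3_zoneBoundary_diff, mul_sub]
  congr 1
  rw [lswtA3_half_zero] at h₁ ⊢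
  rw [lswtOmega3_half_zero, abs_of_nonneg h₁]

/-- The printed approximation `E_ZB ≈ 12ZJ₂[1 + (112 − J₁/J₂)(t′/t)²/12]` equals
`Z(48t⁴/U³ + 448t²t′²/U³ − 4t′²/U)` (`t, U ≠ 0`): it is the exact expression with the `J₂′, J₂″,
J₁′J₁″` terms dropped, i.e. SHORT of the exact value by `17ZJ₂′ = 68Zt′⁴/U³`.
[cite: IvashkoEtAl2019, Methods Eq. (5)] -/
theorem ivashko_EZB_approx_eq {t U : ℝ} (Z tp : ℝ) (ht : t ≠ 0) (hU : U ≠ 0) :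
    12 * Z * lswtJb t U * (1 + (112 - lswtJa t U / lswtJb t U) * (tp / t) ^ 2 / 12) =
      Z * (48 * t ^ 4 / U ^ 3 - 4 * tp ^ 2 / U + 448 * t ^ 2 * tp ^ 2 / U ^ 3 + 68 * tp ^ 4 / U ^ 3)
        - 17 * Z * lswtJb tp U := by
  unfold lswtJa lswtJb; field_simp; ring

/-! ## 5. Worked instances: Ivashko et al. Table 1 fit parameters reproduce the quoted energies -/

/-- LCO/LaSrAlO₄ film (`t = 613.2` meV, `t′ = −0.422t`, `U = 9t`, `Z = 1.219`): `Z·A(½,0) ∈ (359, 361)`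
meV — «the LCO/LSAO magnon reaches about 360 meV» near `(½, 0)`.
[cite: IvashkoEtAl2019, Table 1] -/
theorem ivashko2019_LSAO_halfZero :
    359 < 1.219 * lswtA3 613.2 (-0.422 * 613.2) (0.422 * 613.2 / 2) (9 * 613.2) (1 / 2) 0 ∧
      1.219 * lswtA3 613.2 (-0.422 * 613.2) (0.422 * 613.2 / 2) (9 * 613.2) (1 / 2) 0 < 361 := by
  rw [lswtA3_half_zero]; constructor <;> norm_num

/-- LCO/SrTiO₃ film (`t = 460.5` meV, `t′ = −0.389t`, `U = 9t`, `Z = 1.219`): `Z·A(½,0) ∈ (297, 298)`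
meV — «for LCO/STO a comparative softening of 60 meV». [cite: IvashkoEtAl2019, Table 1] -/
theorem ivashko2019_STO_halfZero :
    297 < 1.219 * lswtA3 460.5 (-0.389 * 460.5) (0.389 * 460.5 / 2) (9 * 460.5) (1 / 2) 0 ∧
      1.219 * lswtA3 460.5 (-0.389 * 460.5) (0.389 * 460.5 / 2) (9 * 460.5) (1 / 2) 0 < 298 := by
  rw [lswtA3_half_zero]; constructor <;> norm_num

end

end Literature.MathematicalPhysics.QuantumLattice
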